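import Literature.Geometry.Lorentzian.KerrAxialKillingField
import Literature.Geometry.Lorentzian.KerrStationaryBlackHole
import Literature.Geometry.Lorentzian.AxisymmetricBlackHoleUniquenessProofs
import HarnessLib

/-!
# The Kerr black hole is stationary-axisymmetric: the flow of `∂_φ`, its `2π`-periodic orbits,
# the axis, and `[∂_{t*}, ∂_φ] = 0`

Family `gr`; namespaces `Literature.Geometry.Lorentzian.E4`, `.Kerr`.

`AxisymmetricBlackHoleUniqueness.lean` vendors the axisymmetric black-hole uniqueness theorem
(Chruściel–Costa–Heusler 2012, Thm. 3.2) under the hypothesis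
`StationaryAFBlackHole.IsStationaryAxisymmetric`: the black hole carries an axisymmetric Killing field
`Y` in the sense of `LorentzianMetric.IsAxisymmetricKilling` (Heusler 1996, Def. 2.6: Killing, complete,
all integral curves `2π`-periodic, not identically zero, non-empty axis) commuting with the stationary
Killing field. This file **verifies that hypothesis on its model**, the Kerr black hole packaged as
`Kerr.stationaryAFBlackHoleOn` (`KerrStationaryBlackHole.lean`), with `Y = ∂_φ = Kerr.axialField`
(Killing by `Kerr.isKillingField_axialField_smoothMetric`, `KerrAxialKillingField.lean`):

* `Kerr.isMIntegralCurve_axialRotate`, `Kerr.isCompleteVectorField_axialField` — the rotations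
  `α ↦ R_α x` (`Kerr.axialRotate`) are integral curves of `∂_φ`, so `∂_φ` is complete;
* `Kerr.eq_axialRotate_of_isMIntegralCurve`, `Kerr.periodic_of_isMIntegralCurve_axialField` — by
  uniqueness of integral curves (Mathlib `isMIntegralCurve_Ioo_eq_of_contMDiff_boundaryless`) every
  integral curve is a rotation orbit, hence `2π`-periodic (`E4.axialRotation_add_two_pi`);
* `Kerr.radius_smul_basisVector_three_eq_abs`, `Kerr.axisPoint_mem_region`, `Kerr.exists_axialField_eq_zero`,
  `Kerr.exists_axialField_ne_zero` — `r(0,0,0,z) = |z|`, so the chart contains axis points (where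
  `∂_φ = 0`) and, being open, nearby points off the axis (where `∂_φ ≠ 0`);
* `Kerr.mlieBracket_stationaryField_axialField` — `[∂_{t*}, ∂_φ] = 0` (`OpensChart.mlieBracket_eq`:
  the bracket of the constant field `∂_{t*}` with the linear field `x ↦ J x` is `J ∂_{t*} = 0`);
* `Kerr.isAxisymmetricKilling_axialField`, **`Kerr.isStationaryAxisymmetric_stationaryAFBlackHoleOn`**,
  `Kerr.isStationaryAxisymmetric_stationaryAFBlackHole` — the conclusions;
* `Kerr.areaFunction_stationary_axial_eq`, `…_pos`, `…_eq_zero_iff`, `Kerr.smoothMetric_areaFunction_eq` —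
  the area function `W = g(T,Y)² − g(T,T)g(Y,Y)` of `(∂_{t*}, ∂_φ)` in closed form `ϖ² Δ/(r² + a²)`
  (`= Δ sin²θ`): positive on the exterior off the axis, zero exactly on the axis;
* `Kerr.image_axialRotate_Mext`, `Kerr.contMDiff_axialRotate_uncurry`,
  `Kerr.image_axialRotate_doc_and_horizon` — the rotations preserve `M_ext` (the asymptotic
  hypothesis of `StationaryAFBlackHole.image_flow_doc_of_image_Mext`, verified on the model), hence the
  domain of outer communications and the event horizon of the Kerr black hole.

All results proved; no named fact is introduced or used beyond the hypotheses of
`Kerr.stationaryAFBlackHoleOn` (`[Kerr.Facts]`, `[Kerr.SliceFacts]`, `Kerr.isAsymptoticallyFlat_data`).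

## References

* B. O'Neill, *The geometry of Kerr black holes*, A K Peters 1995, Ch. 2, §2.2 (the Killing fields
  `∂_t`, `∂_φ`; the isometry group `ℝ × U(1)`) (key `ONeill1995`).
* P. T. Chruściel, J. L. Costa, M. Heusler, *Stationary black holes: uniqueness and beyond*, Living
  Rev. Relativity 15 (2012) 7, §3.2 (p. 10: stationary-axisymmetric black holes) (key
  `ChruscielCostaHeusler2012`).
* M. Heusler, *Black hole uniqueness theorems*, CUP 1996, Def. 2.6 (axisymmetry) (key `Heusler1996`).
* B. O'Neill, *Semi-Riemannian geometry*, Academic Press 1983, Ch. 1, Def. 1.46 ff. (integral curves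
  and their uniqueness) (key `ONeill1983`).
* M. Visser, *The Kerr spacetime: a brief introduction*, arXiv:0706.0622, (35) (key `arXiv07060622`).
-/

noncomputable section

open Bundle Set Function TopologicalSpace
open scoped Manifold ContDiff Topology

namespace Literature.Geometry.Lorentzian

/-! ### The rotations are the flow of the axial field; Kerr is stationary-axisymmetric -/

namespace E4

/-- The rotations are `2π`-periodic in the angle. [folklore] -/
theorem axialRotation_add_two_pi (α : ℝ) (v : E4) :
    axialRotation (α + 2 * Real.pi) v = axialRotation α v := by
  rw [axialRotation_eq_sum, axialRotation_eq_sum, Real.cos_add_two_pi, Real.sin_add_two_pi]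

end E4

namespace Kerr

/-- **The rotations `α ↦ R_α x` are integral curves of the axial field** `∂_φ` (their coordinate
velocity is `J(R_α x)`, `E4.hasDerivAt_axialRotation`; derivatives of maps into the open submanifold
`Kerr.region a r₀ ⊆ E4` are those of the coordinate expression). O'Neill 1995, Ch. 2, §2.2.
[cite: ONeill1995, Ch. 2 §2.2] -/
theorem isMIntegralCurve_axialRotate (a r₀ : ℝ) (x : region a r₀) :
    IsMIntegralCurve (fun α ↦ axialRotate a r₀ α x) (axialField a r₀) := by
  intro α
  have h1 := E4.hasDerivAt_axialRotation (x : E4) α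
  have h2 : HasMFDerivAt 𝓘(ℝ, ℝ) 𝓘(ℝ, E4) (fun β : ℝ ↦ E4.axialRotation β (x : E4)) α
      ((1 : ℝ →L[ℝ] ℝ).smulRight (E4.axialGenerator (E4.axialRotation α (x : E4)))) :=
    hasMFDerivAt_iff_hasFDerivAt.2 h1.hasFDerivAt
  have h3 := OpensChart.hasMFDerivAt_codRestrict (φ := fun β ↦ axialRotate a r₀ β x) (fun _ ↦ rfl) h2
  have e : axialField a r₀ (axialRotate a r₀ α x) = E4.axialGenerator (E4.axialRotation α (x : E4)) :=
    axialField_eq_axialGenerator a r₀ _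
  rw [e]
  exact h3

/-- **`∂_φ` is complete**: its flow is the globally defined rotation group. O'Neill 1995, Ch. 2,
§2.2. [cite: ONeill1995, Ch. 2 §2.2] -/
theorem isCompleteVectorField_axialField (a r₀ : ℝ) : IsCompleteVectorField (axialField a r₀) :=
  fun x ↦ ⟨fun α ↦ axialRotate a r₀ α x, isMIntegralCurve_axialRotate a r₀ x, axialRotate_zero a r₀ x⟩

/-- The axial field is a `C¹` section (Mathlib's integral-curve uniqueness hypothesis). [folklore] -/
theorem contMDiff_axialField (a r₀ : ℝ) :
    ContMDiff 𝓘(ℝ, E4) 𝓘(ℝ, E4).tangent 1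
      (fun y : region a r₀ ↦ (⟨y, axialField a r₀ y⟩ : TangentBundle 𝓘(ℝ, E4) (region a r₀))) :=
  fun x ↦ by rw [ModelWithCorners.tangent]; exact contMDiffAt_axialField a r₀ x

/-- **Every integral curve of `∂_φ` is a rotation orbit**: `γ(α) = R_α(γ(0))` (uniqueness of
integral curves of `C¹` fields, Mathlib `isMIntegralCurve_Ioo_eq_of_contMDiff_boundaryless`).
O'Neill 1983, Ch. 1, Def. 1.46 ff. [cite: ONeill1983, Ch. 1 Def. 1.46 ff.] -/
theorem eq_axialRotate_of_isMIntegralCurve {a r₀ : ℝ} {γ : ℝ → region a r₀}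
    (hγ : IsMIntegralCurve γ (axialField a r₀)) : γ = fun α ↦ axialRotate a r₀ α (γ 0) :=
  isMIntegralCurve_Ioo_eq_of_contMDiff_boundaryless (t₀ := 0) (contMDiff_axialField a r₀) hγ
    (isMIntegralCurve_axialRotate a r₀ (γ 0)) (by simp)

/-- **All integral curves of `∂_φ` are `2π`-periodic** (they are rotation orbits). O'Neill 1995,
Ch. 2, §2.2 (`φ` is an angle). [cite: ONeill1995, Ch. 2 §2.2] -/
theorem periodic_of_isMIntegralCurve_axialField {a r₀ : ℝ} {γ : ℝ → region a r₀}
    (hγ : IsMIntegralCurve γ (axialField a r₀)) : Function.Periodic γ (2 * Real.pi) := by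
  intro α
  rw [eq_axialRotate_of_isMIntegralCurve hγ]
  ext1
  simp only [coe_axialRotate]
  exact E4.axialRotation_add_two_pi α _

/-- On the axis the Kerr–Schild radius is `|z|`: `r(0, 0, 0, z) = |z|` for every real `z` (the
case `z ≥ 0` is `Kerr.radius_smul_basisVector_three` of `KerrRedShiftCoercivity.lean`, not imported
here). Visser arXiv:0706.0622, (35). [cite: arXiv07060622, (35)] -/
theorem radius_smul_basisVector_three_eq_abs (a z : ℝ) : radius a (z • E4.basisVector 3) = |z| := by
  have hn : E4.spatialNorm (z • E4.basisVector 3) ^ 2 = z ^ 2 := by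
    rw [E4.spatialNorm_sq]; simp
  have h3 : (z • E4.basisVector 3) 3 = z := by simp
  have hsq : radius a (z • E4.basisVector 3) ^ 2 = z ^ 2 := by
    rw [radius_sq, hn, h3, show (z ^ 2 - a ^ 2) ^ 2 + 4 * a ^ 2 * z ^ 2 = (z ^ 2 + a ^ 2) ^ 2 by ring,
      Real.sqrt_sq (by positivity)]
    ring
  rw [← Real.sqrt_sq (radius_nonneg a _), hsq, Real.sqrt_sq_eq_abs]

/-- The axis point `(0, 0, 0, max r₀ 0 + 1)` lies in the chart `Kerr.region a r₀`. [folklore] -/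
theorem axisPoint_mem_region (a r₀ : ℝ) : (max r₀ 0 + 1) • E4.basisVector 3 ∈ region a r₀ := by
  rw [mem_region, radius_smul_basisVector_three_eq_abs, abs_of_nonneg (by positivity)]
  linarith

/-- **The axis is non-empty**: `∂_φ` vanishes at the axis points of the chart. [folklore] -/
theorem exists_axialField_eq_zero (a r₀ : ℝ) : ∃ x : region a r₀, axialField a r₀ x = 0 := by
  refine ⟨⟨_, axisPoint_mem_region a r₀⟩, ?_⟩
  have h : E4.axialGenerator ((max r₀ 0 + 1) • E4.basisVector 3) = 0 := by
    rw [E4.axialGenerator_apply]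
    simp
  rw [axialField_eq_axialGenerator]
  exact h

/-- **`∂_φ` is not identically zero** on the chart (the chart is open and contains an axis point;
nearby points off the axis have `∂_φ ≠ 0`). [folklore] -/
theorem exists_axialField_ne_zero (a r₀ : ℝ) : ∃ x : region a r₀, axialField a r₀ x ≠ 0 := by
  set p : E4 := (max r₀ 0 + 1) • E4.basisVector 3 with hp
  obtain ⟨δ, hδ, hball⟩ := Metric.isOpen_iff.1 (region a r₀).2 p (axisPoint_mem_region a r₀)
  set q : E4 := p + (δ / 2) • E4.basisVector 1 with hq
  have hqmem : q ∈ region a r₀ := by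
    refine hball ?_
    rw [Metric.mem_ball, dist_eq_norm, hq, add_sub_cancel_left, norm_smul, Real.norm_eq_abs,
      abs_of_pos (by positivity)]
    have : ‖(E4.basisVector 1 : E4)‖ = 1 := by simp [E4.basisVector]
    rw [this, mul_one]
    linarith
  refine ⟨⟨q, hqmem⟩, fun h ↦ ?_⟩
  have h' : E4.axialGenerator q = (0 : E4) := by
    rw [← axialField_eq_axialGenerator a r₀ ⟨q, hqmem⟩]
    exact h
  have h2 := congrArg (fun v : E4 ↦ v 2) h'
  simp only [E4.axialGenerator_apply_two] at h2
  have hq1 : q 1 = δ / 2 := by simp [hq, hp]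
  rw [hq1] at h2
  have h3 : δ / 2 = 0 := h2.trans (by simp)
  linarith

/-- **`∂_{t*}` and `∂_φ` commute**: `[∂_{t*}, ∂_φ] = 0` (the Lie bracket of a constant and a linear
field in the chart is `J ∂_{t*} − 0 = 0`; `OpensChart.mlieBracket_eq`). O'Neill 1995, Ch. 2, §2.2
(the isometry group `ℝ × U(1)`). [cite: ONeill1995, Ch. 2 §2.2] -/
theorem mlieBracket_stationaryField_axialField (a r₀ : ℝ) (x : region a r₀) :
    VectorField.mlieBracket 𝓘(ℝ, E4) (stationaryField a r₀) (axialField a r₀) x = 0 := by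
  have h : VectorField.lieBracket ℝ (fun _ : E4 ↦ E4.basisVector 0) E4.axialGenerator (x : E4) = 0 := by
    simp [VectorField.lieBracket, ContinuousLinearMap.fderiv]
  rw [OpensChart.mlieBracket_eq x (stationaryField a r₀) (axialField a r₀) (fun _ ↦ E4.basisVector 0)
    E4.axialGenerator (fun _ ↦ rfl) (axialField_eq_axialGenerator a r₀)]
  exact h

/-- **The axial field of the Kerr chart is an axisymmetric Killing field** in the sense of
`LorentzianMetric.IsAxisymmetricKilling` (Heusler 1996, Def. 2.6): Killing, complete, all integral
curves `2π`-periodic, not identically zero, non-empty axis. O'Neill 1995, Ch. 2, §2.2.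
[cite: ONeill1995, Ch. 2 §2.2] -/
theorem isAxisymmetricKilling_axialField [Facts] (M a r₀ : ℝ) [(smoothMetric M a r₀).HasLeviCivita] :
    (smoothMetric M a r₀).IsAxisymmetricKilling (axialField a r₀) :=
  ⟨isKillingField_axialField_smoothMetric M a r₀, isCompleteVectorField_axialField a r₀,
    fun _ hγ ↦ periodic_of_isMIntegralCurve_axialField hγ, exists_axialField_ne_zero a r₀,
    exists_axialField_eq_zero a r₀⟩

/-- **The Kerr black hole is stationary-axisymmetric** in the sense of
`StationaryAFBlackHole.IsStationaryAxisymmetric` (the hypothesis of the axisymmetric uniqueness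
theorem `ChruscielCostaHeusler2012_axisymmetricUniqueness`): `∂_φ` is an axisymmetric Killing field
commuting with the stationary Killing field `∂_{t*}`. This certifies that the hypothesis predicate of
Chruściel–Costa–Heusler 2012, Thm. 3.2 is satisfied by its model. O'Neill 1995, Ch. 2, §2.2;
Chruściel–Costa 2008, §2.1 (Kerr is the model of the uniqueness theorem).
[cite: ChruscielCostaHeusler2012, §3.2 (p. 10)] -/
theorem isStationaryAxisymmetric_stationaryAFBlackHoleOn [Facts] [SliceFacts] (M a r₀ : ℝ)
    (hM : 0 ≤ M) (hAF : isAsymptoticallyFlat_data M a r₀) :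
    (stationaryAFBlackHoleOn M a r₀ hM hAF).IsStationaryAxisymmetric := by
  intro _
  exact ⟨axialField a r₀, isAxisymmetricKilling_axialField M a r₀,
    mlieBracket_stationaryField_axialField a r₀⟩

/-- The sub-extremal Kerr black hole `Kerr.stationaryAFBlackHole M a δ` is stationary-axisymmetric.
[cite: ChruscielCostaHeusler2012, §3.2 (p. 10)] -/
theorem isStationaryAxisymmetric_stationaryAFBlackHole [Facts] [SliceFacts] (M a δ : ℝ)
    (hMa : IsSubextremal M a) (hAF : isAsymptoticallyFlat_data M a (rPlus M a - δ)) :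
    (stationaryAFBlackHole M a δ hMa hAF).IsStationaryAxisymmetric :=
  @isStationaryAxisymmetric_stationaryAFBlackHoleOn _ _ M a (rPlus M a - δ) hMa.pos.le hAF

/-! ### The rotations preserve `M_ext`, hence the domain of outer communications and the horizon -/

/-- **The axial rotations preserve the asymptotic region `M_ext` of the Kerr black hole**:
`R_α(M_ext) = M_ext`, since `M_ext = {(t*, y) | ‖y‖ > R_T + 1}` (`mem_Mext_stationaryAFBlackHoleOn_iff`)
and the rotations preserve the spatial radius. This is, on the model, the hypothesis
`ψ_s(M_ext) = M_ext` of `StationaryAFBlackHole.image_flow_doc_of_image_Mext` (the asymptotic input of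
Chruściel–Costa 2008, p. 13). [cite: ChruscielCosta2008, (2.1) and p. 13] -/
theorem image_axialRotate_Mext [Facts] [SliceFacts] {M : ℝ} (hM : 0 ≤ M) (a r₀ : ℝ)
    (hAF : isAsymptoticallyFlat_data M a r₀) (α : ℝ) :
    axialRotate a r₀ α '' (stationaryAFBlackHoleOn M a r₀ hM hAF).Mext =
      (stationaryAFBlackHoleOn M a r₀ hM hAF).Mext := by
  have hnorm : ∀ (β : ℝ) (x : E4), ‖E4.spatial (E4.axialRotation β x)‖ = ‖E4.spatial x‖ :=
    fun β x ↦ E4.spatialNorm_axialRotation β x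
  ext x
  constructor
  · rintro ⟨y, hy, rfl⟩
    have hy' := (mem_Mext_stationaryAFBlackHoleOn_iff hM a r₀ hAF).1 hy
    refine (mem_Mext_stationaryAFBlackHoleOn_iff hM a r₀ hAF).2 ?_
    rwa [coe_axialRotate, hnorm]
  · intro hx
    refine ⟨axialRotate a r₀ (-α) x, ?_, axialRotate_axialRotate_neg a r₀ α x⟩
    have hx' := (mem_Mext_stationaryAFBlackHoleOn_iff hM a r₀ hAF).1 hx
    refine (mem_Mext_stationaryAFBlackHoleOn_iff hM a r₀ hAF).2 ?_
    rwa [coe_axialRotate, hnorm]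

/-- The rotation flow `(α, x) ↦ R_α x` of the chart is smooth, jointly in the angle and the point.
[folklore] -/
theorem contMDiff_axialRotate_uncurry (a r₀ : ℝ) :
    ContMDiff (𝓘(ℝ, ℝ).prod 𝓘(ℝ, E4)) 𝓘(ℝ, E4) ∞
      (fun p : ℝ × region a r₀ ↦ axialRotate a r₀ p.1 p.2) := by
  intro p
  rw [← ContMDiffAt.subtypeVal_comp_iff]
  have h : (Subtype.val ∘ fun p : ℝ × region a r₀ ↦ axialRotate a r₀ p.1 p.2) =
      fun p : ℝ × region a r₀ ↦ E4.axialRotation p.1 (p.2 : E4) := rfl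
  rw [h]
  have h1 : ContMDiff (𝓘(ℝ, ℝ).prod 𝓘(ℝ, E4)) (𝓘(ℝ, ℝ).prod 𝓘(ℝ, E4)) ∞
      (fun p : ℝ × region a r₀ ↦ ((p.1, (p.2 : E4)) : ℝ × E4)) :=
    contMDiff_fst.prodMk (contMDiff_subtype_val.comp contMDiff_snd)
  have h2 : ContMDiff (𝓘(ℝ, ℝ).prod 𝓘(ℝ, E4)) 𝓘(ℝ, E4) ∞ (fun q : ℝ × E4 ↦ E4.axialRotation q.1 q.2) := by
    have h := contMDiff_iff_contDiff.2 (E4.contDiff_axialRotation_uncurry (n := ∞))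
    rw [modelWithCornersSelf_prod, ← chartedSpaceSelf_prod] at h
    exact h
  exact (h2.comp h1).contMDiffAt

/-- **The axial rotations preserve the domain of outer communications and the event horizon of
the Kerr black hole** — the conditional invariance theorems
`StationaryAFBlackHole.image_flow_doc_of_image_Mext` / `…_horizon_of_image_Mext` applied to the
axial Killing flow of Kerr, whose hypothesis `R_α(M_ext) = M_ext` is `image_axialRotate_Mext`.
Chruściel–Costa 2008, §6.1 (the `U(1)` action on `⟨⟨M_ext⟩⟩`). [cite: ChruscielCosta2008, §6.1] -/
theorem image_axialRotate_doc_and_horizon [Facts] [SliceFacts] {M : ℝ} (hM : 0 ≤ M) (a r₀ : ℝ)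
    (hAF : isAsymptoticallyFlat_data M a r₀) (α : ℝ) :
    axialRotate a r₀ α '' (stationaryAFBlackHoleOn M a r₀ hM hAF).doc =
        (stationaryAFBlackHoleOn M a r₀ hM hAF).doc ∧
      axialRotate a r₀ α '' (stationaryAFBlackHoleOn M a r₀ hM hAF).horizon =
        (stationaryAFBlackHoleOn M a r₀ hM hAF).horizon := by
  haveI : (stationaryAFBlackHoleOn M a r₀ hM hAF).metric.HasLeviCivita :=
    hasLeviCivita_smoothMetric M a r₀
  have hK : (stationaryAFBlackHoleOn M a r₀ hM hAF).metric.IsKillingField (axialField a r₀) :=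
    isKillingField_axialField_smoothMetric M a r₀
  have hψ : ContMDiff (𝓘(ℝ, ℝ).prod (𝓡 4)) (𝓡 4) 2
      (fun p : ℝ × region a r₀ ↦ axialRotate a r₀ p.1 p.2) :=
    (contMDiff_axialRotate_uncurry a r₀).of_le (WithTop.coe_le_coe.mpr le_top)
  have hψ0 : ∀ p : region a r₀, axialRotate a r₀ 0 p = p := axialRotate_zero a r₀
  have hψadd : ∀ (s s' : ℝ) (p : region a r₀),
      axialRotate a r₀ s (axialRotate a r₀ s' p) = axialRotate a r₀ (s + s') p :=
    fun s s' p ↦ (axialRotate_add a r₀ s s' p).symm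
  have hψY : ∀ p : region a r₀, IsMIntegralCurve (fun s ↦ axialRotate a r₀ s p) (axialField a r₀) :=
    isMIntegralCurve_axialRotate a r₀
  have hM' : (fun q ↦ (fun p : ℝ × region a r₀ ↦ axialRotate a r₀ p.1 p.2) (α, q)) ''
      (stationaryAFBlackHoleOn M a r₀ hM hAF).Mext = (stationaryAFBlackHoleOn M a r₀ hM hAF).Mext :=
    image_axialRotate_Mext hM a r₀ hAF α
  exact ⟨StationaryAFBlackHole.image_flow_doc_of_image_Mext (ψ := fun p ↦ axialRotate a r₀ p.1 p.2)
      hK hψ hψ0 hψadd hψY hM',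
    StationaryAFBlackHole.image_flow_horizon_of_image_Mext (ψ := fun p ↦ axialRotate a r₀ p.1 p.2)
      hK hψ hψ0 hψadd hψY hM'⟩

/-! ### The area function `W` of `(∂_{t*}, ∂_φ)` on the model: `W = ϖ² Δ/(r² + a²)` -/

/-- `η(∂_{t*}, J x) = 0`. [folklore] -/
theorem minkowski_basisVector_zero_axialGenerator (x : E4) :
    Minkowski.bilin (E4.basisVector 0) (E4.axialGenerator x) = 0 := by
  simp [Minkowski.bilin_apply, E4.basisVector, Fin.succ_ne_zero]

/-- `η(J x, J x) = x₁² + x₂²`. [folklore] -/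
theorem minkowski_axialGenerator_self (x : E4) :
    Minkowski.bilin (E4.axialGenerator x) (E4.axialGenerator x) = x 1 ^ 2 + x 2 ^ 2 := by
  have e3 : ((2 : Fin 3).succ : Fin 4) = 3 := rfl
  simp only [Minkowski.bilin_apply, Fin.sum_univ_three, Fin.succ_zero_eq_one, Fin.succ_one_eq_two, e3,
    E4.axialGenerator_apply_zero, E4.axialGenerator_apply_one, E4.axialGenerator_apply_two,
    E4.axialGenerator_apply_three]
  ring

/-- `ℓ(J x) = −a (x₁² + x₂²)/(r² + a²)`. [cite: arXiv07060622, (34)] -/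
theorem nullCovector_axialGenerator (a : ℝ) (x : E4) :
    nullCovector a x (E4.axialGenerator x) = -(a * (x 1 ^ 2 + x 2 ^ 2)) / (radius a x ^ 2 + a ^ 2) := by
  rw [nullCovector, E4.covector_apply, Fin.sum_univ_four, nullCovectorFun_apply_one,
    nullCovectorFun_apply_two]
  simp only [E4.axialGenerator_apply_zero, E4.axialGenerator_apply_one, E4.axialGenerator_apply_two,
    E4.axialGenerator_apply_three, mul_zero, zero_add, add_zero]
  have hD : radius a x ^ 2 + a ^ 2 ≠ 0 ∨ radius a x ^ 2 + a ^ 2 = 0 := ne_or_eq _ _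
  rcases hD with hD | hD
  · field_simp
    ring
  · simp [hD]

/-- `(x₁² + x₂²) r² = (r² + a²)(r² − z²)` (the Kerr–Schild quartic, cylindrical form:
`ϖ² = (r² + a²) sin²θ` with `z = r cos θ`). [cite: arXiv07060622, (35)] -/
theorem cylRadius_sq_mul_radius_sq (a : ℝ) (x : E4) :
    (x 1 ^ 2 + x 2 ^ 2) * radius a x ^ 2 = (radius a x ^ 2 + a ^ 2) * (radius a x ^ 2 - x 3 ^ 2) := by
  have hq := radius_quartic a x
  rw [E4.spatialNorm_sq] at hq
  linear_combination (-1 : ℝ) * hq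

/-- **The area function of the pair `(∂_{t*}, ∂_φ)` of the Kerr–Schild metric in closed form**:
`W := g(∂_t, ∂_φ)² − g(∂_t, ∂_t) g(∂_φ, ∂_φ) = (x₁² + x₂²)(r² − 2Mr + a²)/(r² + a²)` wherever `r > 0`,
i.e. `W = Δ sin²θ` in Boyer–Lindquist terms (`x₁² + x₂² = (r² + a²) sin²θ`). Hence on the model of
Chruściel–Costa–Heusler's Thm. 3.2, `W > 0` on the Kerr exterior `{r > r₊}` off the axis, and
`W = 0` exactly on the axis and on the horizons `{Δ = 0}` — the sign structure of Chruściel–Costa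
2008, §5 ((5.1), Thms. 5.4/5.6) on the model. O'Neill 1995, Ch. 2, §2.2 (`g_{tt} g_{φφ} − g_{tφ}² = −Δ sin²θ`).
[cite: ONeill1995, Ch. 2 §2.2] [cite: ChruscielCosta2008, §5 (5.1)] -/
theorem areaFunction_stationary_axial_eq (M a : ℝ) {x : E4} (hx : 0 < radius a x) :
    (bilin M a x (E4.basisVector 0) (E4.axialGenerator x)) ^ 2 -
        bilin M a x (E4.basisVector 0) (E4.basisVector 0) *
          bilin M a x (E4.axialGenerator x) (E4.axialGenerator x) =
      (x 1 ^ 2 + x 2 ^ 2) * (radius a x ^ 2 - 2 * M * radius a x + a ^ 2) /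
        (radius a x ^ 2 + a ^ 2) := by
  set r := radius a x with hr
  set D := r ^ 2 + a ^ 2 with hD
  set ϖ := x 1 ^ 2 + x 2 ^ 2 with hϖ
  have hDpos : 0 < D := by positivity
  have hS : 0 < r ^ 4 + a ^ 2 * x 3 ^ 2 := by positivity
  -- the metric coefficients
  have hL : nullCovector a x (E4.axialGenerator x) = -(a * ϖ) / D := nullCovector_axialGenerator a x
  have htt : bilin M a x (E4.basisVector 0) (E4.basisVector 0) = -1 + 2 * scalarH M a x := by
    rw [bilin_apply, Minkowski.bilin_basisVector_zero, nullCovector_basisVector_zero]; ring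
  have htφ : bilin M a x (E4.basisVector 0) (E4.axialGenerator x) =
      2 * scalarH M a x * (-(a * ϖ) / D) := by
    rw [bilin_apply, minkowski_basisVector_zero_axialGenerator, nullCovector_basisVector_zero, hL]; ring
  have hφφ : bilin M a x (E4.axialGenerator x) (E4.axialGenerator x) =
      ϖ + 2 * scalarH M a x * (-(a * ϖ) / D) ^ 2 := by
    rw [bilin_apply, minkowski_axialGenerator_self, hL]; ring
  -- `H (r⁴ + a² z²) = M r³` and the key identity `H (D² − a² ϖ) = M r D`
  have hH : scalarH M a x * (r ^ 4 + a ^ 2 * x 3 ^ 2) = M * r ^ 3 := by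
    unfold scalarH; rw [← hr]; field_simp
  have hϖr : ϖ * r ^ 2 = D * (r ^ 2 - x 3 ^ 2) := cylRadius_sq_mul_radius_sq a x
  have h3r : scalarH M a x * (D ^ 2 - a ^ 2 * ϖ) * r ^ 2 = M * r * D * r ^ 2 := by
    linear_combination (-(a ^ 2) * scalarH M a x) * hϖr + D * hH
  have h3 : scalarH M a x * (D ^ 2 - a ^ 2 * ϖ) = M * r * D :=
    mul_right_cancel₀ (pow_ne_zero 2 hx.ne') h3r
  rw [htt, htφ, hφφ]
  rw [eq_div_iff hDpos.ne']
  field_simp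
  linear_combination (-2 * ϖ) * h3

/-- `Δ(r) = r² − 2Mr + a² > 0` on the exterior chart `{r > max r₊ 0}`, for all real `M, a`
(`Δ = (r − M)² − (M² − a²)`; for `a² > M²` the root is the junk `0` and `Δ > 0` everywhere).
Boyer–Lindquist 1967; O'Neill 1995, Ch. 2, §2.3. [cite: ONeill1995, Ch. 2 §2.3] -/
theorem horizonFunction_pos_of_mem_exterior {M a : ℝ} {x : E4} (hx : x ∈ exterior M a) :
    0 < radius a x ^ 2 - 2 * M * radius a x + a ^ 2 := by
  have hr : rPlus M a < radius a x := lt_radius_of_mem_region hx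
  unfold rPlus at hr
  have hs : 0 ≤ √(M ^ 2 - a ^ 2) := Real.sqrt_nonneg _
  have h1 : √(M ^ 2 - a ^ 2) < radius a x - M := by linarith
  have h2 : M ^ 2 - a ^ 2 < (radius a x - M) ^ 2 := by
    rcases le_or_gt (M ^ 2 - a ^ 2) 0 with hneg | hpos
    · have h3 : 0 < (radius a x - M) ^ 2 := by
        have : 0 < radius a x - M := hs.trans_lt h1
        positivity
      linarith
    · have h3 : √(M ^ 2 - a ^ 2) ^ 2 = M ^ 2 - a ^ 2 := Real.sq_sqrt hpos.le
      nlinarith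
  nlinarith

/-- **`W > 0` on the Kerr exterior off the axis**: for `r > r₊` and `(x₁, x₂) ≠ (0, 0)` the area
function of `(∂_{t*}, ∂_φ)` is positive (`W = ϖ² Δ/(r² + a²)`, `areaFunction_stationary_axial_eq`) —
including inside the ergoregion, where `∂_{t*}` is spacelike (the content of Chruściel–Costa 2008,
Thms. 5.4/5.6 on the model). [cite: ChruscielCosta2008, §5 Thm. 5.4] -/
theorem areaFunction_stationary_axial_pos (M a : ℝ) {x : E4} (hx : x ∈ exterior M a)
    (hoff : x 1 ≠ 0 ∨ x 2 ≠ 0) :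
    0 < (bilin M a x (E4.basisVector 0) (E4.axialGenerator x)) ^ 2 -
        bilin M a x (E4.basisVector 0) (E4.basisVector 0) *
          bilin M a x (E4.axialGenerator x) (E4.axialGenerator x) := by
  have hr : 0 < radius a x := radius_pos_of_mem_region hx
  rw [areaFunction_stationary_axial_eq M a hr]
  have hΔ := horizonFunction_pos_of_mem_exterior hx
  have hϖ : 0 < x 1 ^ 2 + x 2 ^ 2 := by
    rcases hoff with h | h
    · have := pow_pos (abs_pos.2 h) 2; rw [pow_abs, abs_of_nonneg (sq_nonneg _)] at this; positivity
    · have := pow_pos (abs_pos.2 h) 2; rw [pow_abs, abs_of_nonneg (sq_nonneg _)] at this; positivity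
  positivity

/-- **On the Kerr exterior, `W = 0` exactly on the axis** `{x₁ = x₂ = 0}` (where `∂_φ = 0`).
Chruściel–Costa 2008, §5 ((5.1) and §5.2.2: `W` vanishes on the axis). [cite: ChruscielCosta2008, §5 (5.1)] -/
theorem areaFunction_stationary_axial_eq_zero_iff (M a : ℝ) {x : E4} (hx : x ∈ exterior M a) :
    (bilin M a x (E4.basisVector 0) (E4.axialGenerator x)) ^ 2 -
        bilin M a x (E4.basisVector 0) (E4.basisVector 0) *
          bilin M a x (E4.axialGenerator x) (E4.axialGenerator x) = 0 ↔
      x 1 = 0 ∧ x 2 = 0 := by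
  constructor
  · intro h
    by_contra hne
    have hoff : x 1 ≠ 0 ∨ x 2 ≠ 0 := by
      by_contra h'
      push Not at h'
      exact hne h'
    exact (areaFunction_stationary_axial_pos M a hx hoff).ne' h
  · rintro ⟨h1, h2⟩
    have hr : 0 < radius a x := radius_pos_of_mem_region hx
    rw [areaFunction_stationary_axial_eq M a hr, h1, h2]
    simp

/-- The area function of the stationary and axial Killing fields of the Kerr chart
`Kerr.region a r₀`, as the expression `g(T, Y)² − g(T, T) g(Y, Y)` of
`AxisymmetricBlackHoleUniquenessProofs.lean` for `g = Kerr.smoothMetric`, `T = Kerr.stationaryField`,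
`Y = Kerr.axialField`, in closed form. [cite: ONeill1995, Ch. 2 §2.2] -/
theorem smoothMetric_areaFunction_eq [Facts] (M a r₀ : ℝ) (x : region a r₀) :
    (smoothMetric M a r₀).val x (stationaryField a r₀ x) (axialField a r₀ x) ^ 2 -
        (smoothMetric M a r₀).val x (stationaryField a r₀ x) (stationaryField a r₀ x) *
          (smoothMetric M a r₀).val x (axialField a r₀ x) (axialField a r₀ x) =
      ((x : E4) 1 ^ 2 + (x : E4) 2 ^ 2) *
          (radius a x ^ 2 - 2 * M * radius a x + a ^ 2) / (radius a x ^ 2 + a ^ 2) := by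
  have h := areaFunction_stationary_axial_eq M a (radius_pos_of_mem_region x.2)
  rw [← axialField_eq_axialGenerator a r₀ x] at h
  exact h

/-- `Δ(r₊) = 0` for `|a| ≤ M` (`r₊ = M + √(M² − a²)` is the larger root of `r² − 2Mr + a²`).
O'Neill 1995, Ch. 2, §2.3. [cite: ONeill1995, Ch. 2 §2.3] -/
theorem horizonFunction_rPlus {M a : ℝ} (h : |a| ≤ M) :
    rPlus M a ^ 2 - 2 * M * rPlus M a + a ^ 2 = 0 := by
  have hM : 0 ≤ M := (abs_nonneg a).trans h
  have ha : a ^ 2 ≤ M ^ 2 := by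
    have := sq_le_sq' (abs_le.1 h).1 (abs_le.1 h).2
    simpa using this
  have hs : √(M ^ 2 - a ^ 2) ^ 2 = M ^ 2 - a ^ 2 := Real.sq_sqrt (sub_nonneg.2 ha)
  unfold rPlus
  nlinarith [hs]

/-- **`W = 0` on the event horizon `{r = r₊}` of the Kerr chart** (`|a| ≤ M`): the area function of
`(∂_{t*}, ∂_φ)` vanishes where `Δ(r) = 0` (`W = ϖ² Δ/(r² + a²)`). On the horizon the Killing field
`K = ∂_{t*} + Ω_H ∂_φ` is null and tangent, hence orthogonal to `∂_{t*}` and `∂_φ`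
(`areaFunction_eq_zero_of_orthogonal_combination` is the abstract mechanism; Chruściel–Costa 2008,
§5.2 and §7.1). [cite: ChruscielCosta2008, §5.2 (p. 19)] [cite: ONeill1995, Ch. 2 §2.3] -/
theorem areaFunction_stationary_axial_eq_zero_of_radius_eq_rPlus {M a : ℝ} (h : |a| ≤ M) {x : E4}
    (hr : radius a x = rPlus M a) (hpos : 0 < radius a x) :
    (bilin M a x (E4.basisVector 0) (E4.axialGenerator x)) ^ 2 -
        bilin M a x (E4.basisVector 0) (E4.basisVector 0) *
          bilin M a x (E4.axialGenerator x) (E4.axialGenerator x) = 0 := by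
  rw [areaFunction_stationary_axial_eq M a hpos, hr, horizonFunction_rPlus h]
  simp

/-- **`W < 0` strictly between the horizons, off the axis** (`r₋ < r < r₊`, subextremal `|a| < M`):
there `Δ(r) = (r − r₊)(r − r₋) < 0`, so the span of `∂_{t*}, ∂_φ` is timelike (a Lorentzian
2-plane) — the region where no combination of the two Killing fields is timelike or null is absent,
and stationarity in the sense of `M_ext` fails. O'Neill 1995, Ch. 2, §2.5 (Boyer–Lindquist block II).
[cite: ONeill1995, Ch. 2 §2.5] -/
theorem areaFunction_stationary_axial_neg_of_mem_Ioo {M a : ℝ} (h : IsSubextremal M a) {x : E4}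
    (hr : radius a x ∈ Set.Ioo (rMinus M a) (rPlus M a)) (hpos : 0 < radius a x)
    (hoff : x 1 ≠ 0 ∨ x 2 ≠ 0) :
    (bilin M a x (E4.basisVector 0) (E4.axialGenerator x)) ^ 2 -
        bilin M a x (E4.basisVector 0) (E4.basisVector 0) *
          bilin M a x (E4.axialGenerator x) (E4.axialGenerator x) < 0 := by
  rw [areaFunction_stationary_axial_eq M a hpos]
  have ha : a ^ 2 < M ^ 2 := sq_lt_sq' (abs_lt.1 h).1 (abs_lt.1 h).2
  have hs : √(M ^ 2 - a ^ 2) ^ 2 = M ^ 2 - a ^ 2 := Real.sq_sqrt (sub_pos.2 ha).le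
  have hΔ : radius a x ^ 2 - 2 * M * radius a x + a ^ 2 =
      (radius a x - rPlus M a) * (radius a x - rMinus M a) := by
    unfold rPlus rMinus
    nlinarith [hs]
  have hneg : radius a x ^ 2 - 2 * M * radius a x + a ^ 2 < 0 := by
    rw [hΔ]
    exact mul_neg_of_neg_of_pos (sub_neg.2 hr.2) (sub_pos.2 hr.1)
  have hϖ : 0 < x 1 ^ 2 + x 2 ^ 2 := by
    rcases hoff with h1 | h1
    · have := pow_pos (abs_pos.2 h1) 2; rw [pow_abs, abs_of_nonneg (sq_nonneg _)] at this; positivity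
    · have := pow_pos (abs_pos.2 h1) 2; rw [pow_abs, abs_of_nonneg (sq_nonneg _)] at this; positivity
  have hD : 0 < radius a x ^ 2 + a ^ 2 := by positivity
  exact div_neg_of_neg_of_pos (mul_neg_of_pos_of_neg hϖ hneg) hD

end Kerr

end Literature.Geometry.Lorentzian
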